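import Literature.NumberTheory.EllipticCurves.RationalIsogenyDegreesProofs
import Literature.NumberTheory.EllipticCurves.KleinFrickeLevelSevenTorsion
import HarnessLib

/-!
# Kenku's level `49`, the core of the glue over a field of characteristic `0`
# (`X₀(49) ≅ X_sp(7)`; Kubert 1976, Table 3; Kenku 1982, p. 200)

Topic `NumberTheory/EllipticCurves`; a PROOFS file (theorems only, no `def`, no named fact; net
debt `0`). File 3 of 4 (part 1 of 2 of the glue) of the `Literature/` PORT of the tree's proved
level-`49` theorem of Kenku (no elliptic curve over `ℚ` has a rational cyclic `49`-isogeny — the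
`n = 49` leaf of Mazur's "First reduction", named fact
`Literature.NumberTheory.EllipticCurves.Mazur1977_reduction_to_primes`).

PORT. Source (PROVED, Summits-side, read-only here):
`Summits/ABC/ABC/Theorems/IsogenyGlueCongruenceMazurKenkuBoundStubLevelFortyNineGlue.lean`
(proposal p174127, route `IsogenyGlueCongruence`, crux `MazurKenkuBound`, 383 lines; sha256 in the
`-- PORT:` line 1), its sections "Small field lemmas", "Two affine points with the same
`x`-coordinate", "The multiples `±P, ±2P, ±3P` …" and "The core" — i.e. everything up to and
including `levelFortyNine_core`; the remaining section "The glue over `ℚ`"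
(`rat_sq_ne_neg_twentySeven`, `stub_levelFortyNineGlue`) is part 2, file
`KenkuLevelFortyNineProofs` (the split keeps both files under the 400-line cap). Ported
declarations, 1 : 1, statements and tactic scripts VERBATIM, namespace `Summit.ABC.ABC.Theorems` ↦
`Literature.NumberTheory.EllipticCurves`, names unchanged: `klein_seven_j_ne`,
`c₄_c₆_baseChange_ne_zero`, `point_eq_or_eq_neg_of_x_eq`, `mem_zmultiples_of_kubert_x`,
`levelFortyNine_core`. Nothing is re-stated beyond the namespace (a `Literature/` file may not
import `Summits.*`, CONVENTIONS §2) and ONE modifier: the three `[folklore]` helper lemmas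
`klein_seven_j_ne`, `c₄_c₆_baseChange_ne_zero`, `point_eq_or_eq_neg_of_x_eq` (used only inside
this file, here as in the source) are declared `private`, because the `Literature/` lint
`literature-cited-only` admits a bare `[folklore]` tag on private helpers only; the Summits file is
untouched. Imports: the two `Literature`
modules the source reached through its Summits-side imports (`RationalIsogenyDegreesProofs` via
`…StubMiddleSeven`, `KleinFrickeLevelSevenTorsion` via `…StubHauptmodulSeven`). Ported by
bsd-cited-r19 (ARM P lead ruling (452)(a), OPS 2026-08-27T09:49Z).

WHAT (the source's account of the whole glue; inputs (A)–(D) are the files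
`CyclicIsogenyFortyNineMiddleCurveProofs` (`middleSeven`), `KleinFrickeLevelSevenTorsion`
(`WeierstrassCurve.hauptmodul_seven_of_torsion_some`), `KubertSevenRigidityProofs`
(`kubertSevenRigidity`) and `XZeroFortyNineExplicit` + `Curve49A1Points`; here (B) and (C) enter
`levelFortyNine_core` as HYPOTHESES, exactly as in the source). No elliptic curve over `ℚ` admits a
rational CYCLIC isogeny of degree `49`, from four inputs —
(A) the quotient `V₁ = V/⟨7P⟩` carries two distinct `Γ_ℚ`-stable cyclic subgroups `ℤP₁ ≠ ℤP₂` of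
order `7`, (B) Klein–Fricke at `7` from a torsion point WITH the value `η` of the Hauptmodul and
Kubert's shape of the tangent-normalised coefficients, (C) two Kubert normalisations of one
equation with the same Hauptmodul value differ by a multiple of the base point and (D) two
distinct nonzero rationals never share a value of `R₇(h) = (h²+13h+49)(h²+5h+1)³/h`: `X₀(49) ≅ 49a1`
has only its two rational cusps.

The argument (`X₀(49) ≅ X_sp(7)`): the two subgroups give `s = η(P₁)`, `t = η(P₂) ∈ ℚ` with
`j(V₁)·s = P(s)`, `j(V₁)·t = P(t)`. If `s = t`, the two Tate parameters `d(P₁), d(P₂) ∈ ℚ̄` have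
the same Hauptmodul value, so by (C) (applied to the tangent normalisations at `P₁`, `P₂`, whose
coefficients (B) puts in Kubert's shape; `c₄c₆ ≠ 0` because `j ∉ {0, 1728}`: `P` has no rational
root and `P(h) - 1728h` is the square of a quartic without rational root) `x(P₂) ∈ {x(P₁), x(2P₁),
x(3P₁)}` (`x(2P₀) = -a₂`, `x(3P₀) = a₃(a₃ - a₁a₂)/a₂²` on the normal form, tree lemmas
`two_smul_zero_zero`, `three_smul_zero_zero`), whence `P₂ ∈ ℤP₁` — excluded by (A). So `s ≠ t`,
`st ≠ 0` (`P(0) = 49`), `P(s)t = jst = P(t)s`, and (D) ends the proof.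

## References

* [Kenku1982] M. A. Kenku, *On the number of `ℚ`-isomorphism classes of elliptic curves in each
  `ℚ`-isogeny class*, J. Number Theory 15 (1982) 199–202, proof of Thm. 1, p. 200 (level `49`).
* [Ligozat1975] G. Ligozat, *Courbes modulaires de genre 1*, Mém. SMF 43 (1975) (`X₀(49)`).
* [Kubert1976] D. S. Kubert, *Universal bounds on the torsion of elliptic curves*, Proc. London
  Math. Soc. (3) 33 (1976) 193–237, Table 3 (the form `E(b, c)` of `X₁(7)`).
* [SilvermanAEC2009] J. H. Silverman, *The Arithmetic of Elliptic Curves*, 2nd ed., GTM 106,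
  III.1 Table 3.1.
-/

noncomputable section

open scoped Classical

open WeierstrassCurve

namespace Literature.NumberTheory.EllipticCurves

/-! ### Small field lemmas -/

/-- From `j η = P(η)`, `P(η) = (η² + 13η + 49)(η² + 5η + 1)³`, in a field of characteristic `0` in
which neither `21` nor `-27` is a square and `u⁴ + 14u³ + 63u² + 70u - 7` has no root:
`η ≠ 0` (`P(0) = 49`), `j ≠ 0` (`4(η² + 13η + 49) = (2η + 13)² + 27`, `4(η² + 5η + 1) =
(2η + 5)² - 21`) and `j ≠ 1728` (`P(η) - 1728η = (η⁴ + 14η³ + 63η² + 70η - 7)²`). [folklore] -/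
private theorem klein_seven_j_ne {K : Type*} [Field K] [CharZero K] (h21 : ∀ u : K, u ^ 2 ≠ 21)
    (h27 : ∀ u : K, u ^ 2 ≠ -27) (hq : ∀ u : K, u ^ 4 + 14 * u ^ 3 + 63 * u ^ 2 + 70 * u - 7 ≠ 0)
    {j η : K} (hj : j * η = (η ^ 2 + 13 * η + 49) * (η ^ 2 + 5 * η + 1) ^ 3) :
    η ≠ 0 ∧ j ≠ 0 ∧ j ≠ 1728 := by
  have hP : (η ^ 2 + 13 * η + 49) * (η ^ 2 + 5 * η + 1) ^ 3 ≠ 0 := by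
    refine mul_ne_zero ?_ (pow_ne_zero 3 ?_)
    · exact fun h ↦ h27 (2 * η + 13) (by linear_combination 4 * h)
    · exact fun h ↦ h21 (2 * η + 5) (by linear_combination 4 * h)
  refine ⟨?_, ?_, ?_⟩
  · rintro rfl
    apply hP
    have : (49 : K) = 0 := by linear_combination -hj
    norm_num at this
  · rintro rfl
    exact hP (by rw [← hj, zero_mul])
  · rintro rfl
    have h2 : (η ^ 4 + 14 * η ^ 3 + 63 * η ^ 2 + 70 * η - 7) ^ 2 = 0 := by
      linear_combination -hj
    exact hq η (pow_eq_zero_iff two_ne_zero |>.1 h2)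

/-- `c₄ ≠ 0` and `c₆ ≠ 0` for an elliptic curve with `j ∉ {0, 1728}`, also after base change to an
extension field (`j = c₄³/Δ`, `1728Δ = c₄³ - c₆²`). [folklore] -/
private theorem c₄_c₆_baseChange_ne_zero {K : Type*} [Field K] {V₁ : WeierstrassCurve K} [V₁.IsElliptic]
    (hj0 : V₁.j ≠ 0) (hj1728 : V₁.j ≠ 1728) (L : Type*) [Field L] [Algebra K L] :
    (V₁.baseChange L).c₄ ≠ 0 ∧ (V₁.baseChange L).c₆ ≠ 0 := by
  have hc4 : V₁.c₄ ≠ 0 := fun h0 ↦ hj0 (V₁.j_eq_zero h0)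
  have hc6 : V₁.c₆ ≠ 0 := by
    intro h0
    apply hj1728
    have hrel := V₁.c_relation
    rw [h0, zero_pow two_ne_zero, sub_zero] at hrel
    rw [WeierstrassCurve.j, Units.inv_mul_eq_iff_eq_mul, coe_Δ', ← hrel]
    ring
  have h4 : (V₁.baseChange L).c₄ = algebraMap K L V₁.c₄ := V₁.map_c₄ _
  have h6 : (V₁.baseChange L).c₆ = algebraMap K L V₁.c₆ := V₁.map_c₆ _
  rw [h4, h6]
  exact ⟨(map_ne_zero _).2 hc4, (map_ne_zero _).2 hc6⟩

/-! ### Two affine points with the same `x`-coordinate -/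

/-- On a Weierstrass curve over a field, two points with the same `x`-coordinate are equal or
opposite. [folklore] -/
private theorem point_eq_or_eq_neg_of_x_eq {F : Type*} [Field F] {W : WeierstrassCurve F} {x y y' : F}
    (h : W.toAffine.Nonsingular x y) (h' : W.toAffine.Nonsingular x y') :
    (Affine.Point.some x y' h' : W.toAffine.Point) = .some x y h ∨
      (Affine.Point.some x y' h' : W.toAffine.Point) = -.some x y h := by
  have e := (Affine.equation_iff ..).mp h.1
  have e' := (Affine.equation_iff ..).mp h'.1
  have key : (y' - y) * (y' - W.toAffine.negY x y) = 0 := by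
    rw [Affine.negY]
    linear_combination e' - e
  rcases mul_eq_zero.1 key with h0 | h0
  · left
    have hy : y' = y := sub_eq_zero.1 h0
    subst hy
    rfl
  · right
    have hy : y' = W.toAffine.negY x y := sub_eq_zero.1 h0
    rw [Affine.Point.neg_some]
    subst hy
    rfl

/-! ### The multiples `±P, ±2P, ±3P` of a point with Kubert normal form, by `x`-coordinate -/

/-- Let `P₁ = (x₁, y₁)` be a point of `E` (over a field) whose tangent-normalised coefficients have
Kubert's level-`7` shape with parameters `(d, u)`, `ud(d - 1) ≠ 0`. Then `x(2P₁) = x₁ + u²d²(d-1)`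
and `x(3P₁) = x₁ + u²d(d-1)` (`x(2P₀) = -a₂`, `x(3P₀) = a₃(a₃ - a₁a₂)/a₂²` on the normal form —
tree lemmas `two_smul_zero_zero`, `three_smul_zero_zero` — transported by `pointEquiv`), so a
point `P₂ = (x₂, y₂)` with `x₂ ∈ {x₁, x(2P₁), x(3P₁)}` lies in `ℤP₁`. [cite: Kubert1976, Table 3]
[cite: SilvermanAEC2009, III.1 Table 3.1] -/
theorem mem_zmultiples_of_kubert_x {L : Type*} [Field L] {E : WeierstrassCurve L}
    {x₁ y₁ x₂ y₂ : L} (h₁ : E.toAffine.Nonsingular x₁ y₁) (h₂ : E.toAffine.Nonsingular x₂ y₂)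
    (hy₁ : y₁ ≠ E.toAffine.negY x₁ y₁) {u d : L} (hu : u ≠ 0) (hd : d ≠ 0) (hd1 : d - 1 ≠ 0)
    (ha1 : E.tgA₁ x₁ y₁ = u * (1 - d * (d - 1)))
    (ha2 : E.tgA₂ x₁ y₁ = -(u ^ 2 * (d ^ 2 * (d - 1))))
    (ha3 : E.tgA₃ x₁ y₁ = -(u ^ 3 * (d ^ 2 * (d - 1))))
    (hx : x₂ = x₁ ∨ x₂ = x₁ + u ^ 2 * (d ^ 2 * (d - 1)) ∨ x₂ = x₁ + u ^ 2 * (d * (d - 1))) :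
    (Affine.Point.some x₂ y₂ h₂ : E.toAffine.Point) ∈
      AddSubgroup.zmultiples (Affine.Point.some x₁ y₁ h₁ : E.toAffine.Point) := by
  have hV' := variableChange_tangent_eq (W := E) h₁.1 hy₁
  obtain ⟨h₀, hP'⟩ := pointEquiv_tangent_some (W := E) h₁
  have hCu : (((⟨1, x₁, E.toAffine.slope x₁ x₁ y₁ y₁, y₁⟩ : VariableChange L).u : Lˣ) : L) = 1 :=
    Units.val_one
  have hCr : (⟨1, x₁, E.toAffine.slope x₁ x₁ y₁ y₁, y₁⟩ : VariableChange L).r = x₁ := rfl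
  revert hV' h₀ hP' hCu hCr
  generalize (⟨1, x₁, E.toAffine.slope x₁ x₁ y₁ y₁, y₁⟩ : VariableChange L) = C
  intro hV' h₀ hP' hCu hCr
  have hb1 : (C • E).a₁ = u * (1 - d * (d - 1)) := by rw [hV']; exact ha1
  have hb2 : (C • E).a₂ = -(u ^ 2 * (d ^ 2 * (d - 1))) := by rw [hV']; exact ha2
  have hb3 : (C • E).a₃ = -(u ^ 3 * (d ^ 2 * (d - 1))) := by rw [hV']; exact ha3
  have hb4 : (C • E).a₄ = 0 := by rw [hV']
  have hb6 : (C • E).a₆ = 0 := by rw [hV']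
  have h3' : (C • E).a₃ ≠ 0 := by
    rw [hb3]
    exact neg_ne_zero.2 (mul_ne_zero (pow_ne_zero 3 hu) (mul_ne_zero (pow_ne_zero 2 hd) hd1))
  have h2' : (C • E).a₂ ≠ 0 := by
    rw [hb2]
    exact neg_ne_zero.2 (mul_ne_zero (pow_ne_zero 2 hu) (mul_ne_zero (pow_ne_zero 2 hd) hd1))
  obtain ⟨hQ, h2Q⟩ := two_smul_zero_zero hb4 hb6 h3'
  obtain ⟨hT, h3T⟩ := three_smul_zero_zero hb4 hb6 h3' h2'
  -- `2P₁` and `3P₁` on `E`, through the isomorphism of point groups `pointEquiv E C`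
  have h2P : (Affine.Point.some _ _ h₁ : E.toAffine.Point) + .some _ _ h₁ =
      (VariableChange.pointEquiv E C).symm
        (.some (-(C • E).a₂) ((C • E).a₁ * (C • E).a₂ - (C • E).a₃) hQ) := by
    apply (VariableChange.pointEquiv E C).injective
    rw [map_add, hP', AddEquiv.apply_symm_apply]
    exact h2Q
  have h3P : (Affine.Point.some _ _ h₁ : E.toAffine.Point) + (.some _ _ h₁ + .some _ _ h₁) =
      (VariableChange.pointEquiv E C).symm
        (.some ((C • E).a₃ * ((C • E).a₃ - (C • E).a₁ * (C • E).a₂) / (C • E).a₂ ^ 2)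
          (-((C • E).a₃ * ((C • E).a₂ ^ 3 - (C • E).a₁ * (C • E).a₂ * (C • E).a₃ +
            (C • E).a₃ ^ 2)) / (C • E).a₂ ^ 3) hT) := by
    apply (VariableChange.pointEquiv E C).injective
    rw [map_add, map_add, hP', AddEquiv.apply_symm_apply]
    exact h3T
  rw [VariableChange.pointEquiv_symm_apply, VariableChange.pointInv_some] at h2P h3P
  have hx2P : C.ofX (-(C • E).a₂) = x₁ + u ^ 2 * (d ^ 2 * (d - 1)) := by
    rw [VariableChange.ofX_def, hb2, hCu, hCr]
    ring
  have hx3P : C.ofX ((C • E).a₃ * ((C • E).a₃ - (C • E).a₁ * (C • E).a₂) / (C • E).a₂ ^ 2) =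
      x₁ + u ^ 2 * (d * (d - 1)) := by
    rw [VariableChange.ofX_def, hb1, hb2, hb3, hCu, hCr]
    field_simp
    ring
  have memP₁ : (Affine.Point.some _ _ h₁ : E.toAffine.Point) ∈
      AddSubgroup.zmultiples (Affine.Point.some _ _ h₁ : E.toAffine.Point) :=
    AddSubgroup.mem_zmultiples _
  rcases hx with hx | hx | hx
  · -- `x₂ = x₁`: `P₂ = ± P₁`
    subst hx
    rcases point_eq_or_eq_neg_of_x_eq h₁ h₂ with e | e <;> rw [e]
    · exact memP₁
    · exact neg_mem memP₁
  · -- `x₂ = x(2P₁)`: `P₂ = ± 2P₁`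
    rw [← hx2P] at hx
    subst hx
    rcases point_eq_or_eq_neg_of_x_eq
      ((VariableChange.nonsingular_ofXY_iff E C _ _).mpr hQ) h₂ with e | e <;> rw [e, ← h2P]
    · exact add_mem memP₁ memP₁
    · exact neg_mem (add_mem memP₁ memP₁)
  · -- `x₂ = x(3P₁)`: `P₂ = ± 3P₁`
    rw [← hx3P] at hx
    subst hx
    rcases point_eq_or_eq_neg_of_x_eq
      ((VariableChange.nonsingular_ofXY_iff E C _ _).mpr hT) h₂ with e | e <;> rw [e, ← h3P]
    · exact add_mem memP₁ (add_mem memP₁ memP₁)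
    · exact neg_mem (add_mem memP₁ (add_mem memP₁ memP₁))

/-! ### The core, over a field of characteristic `0` -/

/-- **Core of the level-`49` glue** over a field `K` of characteristic `0` in which `21`, `-27` are
not squares and the level-`7`/`j = 1728` quartic has no root: two points `P₁, P₂ ∈ V₁(K̄)` of order
`7` with `Γ_K`-stable, DISTINCT cyclic subgroups give two DISTINCT nonzero `s, t ∈ K` with
`P(s)t = P(t)s` (from stubs B and C, stated as hypotheses). [cite: Kubert1976, Table 3]
[cite: Kenku1982, proof of Thm. 1, p. 200] -/
theorem levelFortyNine_core {K : Type} [Field K] [CharZero K] (h21 : ∀ u : K, u ^ 2 ≠ 21)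
    (h27 : ∀ u : K, u ^ 2 ≠ -27) (hq : ∀ u : K, u ^ 4 + 14 * u ^ 3 + 63 * u ^ 2 + 70 * u - 7 ≠ 0)
    (hB :
      ∀ {F : Type} [Field F] {L : Type} [Field L] [Algebra F L] [IsGalois F L]
      (W : WeierstrassCurve F) [W.IsElliptic] {x y : L}
      {h : (W.baseChange L).toAffine.Nonsingular x y},
      addOrderOf (Affine.Point.some x y h : (W.baseChange L).toAffine.Point) = 7 →
      (∀ σ : L ≃ₐ[F] L, σ • (Affine.Point.some x y h : (W.baseChange L).toAffine.Point) ∈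
          AddSubgroup.zmultiples (Affine.Point.some x y h : (W.baseChange L).toAffine.Point)) →
      (W.baseChange L).tgA₂ x y ≠ 0 ∧ (W.baseChange L).tgA₃ x y ≠ 0 ∧
      (W.baseChange L).tgA₃ x y - (W.baseChange L).tgA₁ x y * (W.baseChange L).tgA₂ x y ≠ 0 ∧
      ∀ d u : L,
        d = -(W.baseChange L).tgA₂ x y ^ 3 /
              ((W.baseChange L).tgA₃ x y *
                ((W.baseChange L).tgA₃ x y - (W.baseChange L).tgA₁ x y * (W.baseChange L).tgA₂ x y)) →
        u = (W.baseChange L).tgA₃ x y / (W.baseChange L).tgA₂ x y →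
        d ≠ 0 ∧ d - 1 ≠ 0 ∧
        (W.baseChange L).tgA₁ x y = u * (1 - d * (d - 1)) ∧
        (W.baseChange L).tgA₂ x y = -(u ^ 2 * (d ^ 2 * (d - 1))) ∧
        (W.baseChange L).tgA₃ x y = -(u ^ 3 * (d ^ 2 * (d - 1))) ∧
        ∃ η : F, W.j * η = (η ^ 2 + 13 * η + 49) * (η ^ 2 + 5 * η + 1) ^ 3 ∧
          algebraMap F L η * (d * (d - 1)) = d ^ 3 - 8 * d ^ 2 + 5 * d + 1)
    (hC :
      ∀ {L : Type} [Field L] [CharZero L] (E : WeierstrassCurve L) (C C' : VariableChange L)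
      (u d u' d' : L),
      C.u = 1 → C'.u = 1 →
      (C • E).a₁ = u * (1 - d * (d - 1)) → (C • E).a₂ = -(u ^ 2 * (d ^ 2 * (d - 1))) →
      (C • E).a₃ = -(u ^ 3 * (d ^ 2 * (d - 1))) → (C • E).a₄ = 0 → (C • E).a₆ = 0 →
      (C' • E).a₁ = u' * (1 - d' * (d' - 1)) → (C' • E).a₂ = -(u' ^ 2 * (d' ^ 2 * (d' - 1))) →
      (C' • E).a₃ = -(u' ^ 3 * (d' ^ 2 * (d' - 1))) → (C' • E).a₄ = 0 → (C' • E).a₆ = 0 →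
      u ≠ 0 → u' ≠ 0 → d * (d - 1) ≠ 0 → d' * (d' - 1) ≠ 0 →
      (d ^ 3 - 8 * d ^ 2 + 5 * d + 1) * (d' * (d' - 1)) =
        (d' ^ 3 - 8 * d' ^ 2 + 5 * d' + 1) * (d * (d - 1)) →
      E.c₄ ≠ 0 → E.c₆ ≠ 0 →
      C'.r = C.r ∨ C'.r = C.r + u ^ 2 * (d ^ 2 * (d - 1)) ∨ C'.r = C.r + u ^ 2 * (d * (d - 1)))
    (V₁ : WeierstrassCurve K) [V₁.IsElliptic] (P₁ P₂ : V₁.geomPoints) (ho₁ : addOrderOf P₁ = 7)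
    (ho₂ : addOrderOf P₂ = 7)
    (hst₁ : ∀ σ : Field.absoluteGaloisGroup K, σ • P₁ ∈ AddSubgroup.zmultiples P₁)
    (hst₂ : ∀ σ : Field.absoluteGaloisGroup K, σ • P₂ ∈ AddSubgroup.zmultiples P₂)
    (hne : P₂ ∉ AddSubgroup.zmultiples P₁) :
    ∃ s t : K, s ≠ t ∧ s ≠ 0 ∧ t ≠ 0 ∧
      (s ^ 2 + 13 * s + 49) * (s ^ 2 + 5 * s + 1) ^ 3 * t =
        (t ^ 2 + 13 * t + 49) * (t ^ 2 + 5 * t + 1) ^ 3 * s := by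
  haveI : IsGalois K (AlgebraicClosure K) := {}
  haveI : (V₁.baseChange (AlgebraicClosure K)).IsElliptic := by rw [baseChange]; infer_instance
  -- both points are affine
  have hP₁0 : P₁ ≠ 0 := fun e ↦ by rw [e, addOrderOf_zero] at ho₁; omega
  have hP₂0 : P₂ ≠ 0 := fun e ↦ by rw [e, addOrderOf_zero] at ho₂; omega
  rcases P₁ with _ | ⟨x₁, y₁, h₁⟩
  · exact absurd rfl hP₁0
  rcases P₂ with _ | ⟨x₂, y₂, h₂⟩
  · exact absurd rfl hP₂0
  -- (B) at `P₁` and at `P₂`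
  obtain ⟨hA2₁, hA3₁, -, hrest₁⟩ := hB (W := V₁) ho₁ hst₁
  obtain ⟨hA2₂, hA3₂, -, hrest₂⟩ := hB (W := V₁) ho₂ hst₂
  obtain ⟨d₁, hd₁def⟩ : ∃ d : AlgebraicClosure K, d =
      -(V₁.baseChange (AlgebraicClosure K)).tgA₂ x₁ y₁ ^ 3 /
        ((V₁.baseChange (AlgebraicClosure K)).tgA₃ x₁ y₁ *
          ((V₁.baseChange (AlgebraicClosure K)).tgA₃ x₁ y₁ -
            (V₁.baseChange (AlgebraicClosure K)).tgA₁ x₁ y₁ *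
              (V₁.baseChange (AlgebraicClosure K)).tgA₂ x₁ y₁)) := ⟨_, rfl⟩
  obtain ⟨u₁, hu₁def⟩ : ∃ u : AlgebraicClosure K, u =
      (V₁.baseChange (AlgebraicClosure K)).tgA₃ x₁ y₁ /
        (V₁.baseChange (AlgebraicClosure K)).tgA₂ x₁ y₁ := ⟨_, rfl⟩
  obtain ⟨d₂, hd₂def⟩ : ∃ d : AlgebraicClosure K, d =
      -(V₁.baseChange (AlgebraicClosure K)).tgA₂ x₂ y₂ ^ 3 /
        ((V₁.baseChange (AlgebraicClosure K)).tgA₃ x₂ y₂ *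
          ((V₁.baseChange (AlgebraicClosure K)).tgA₃ x₂ y₂ -
            (V₁.baseChange (AlgebraicClosure K)).tgA₁ x₂ y₂ *
              (V₁.baseChange (AlgebraicClosure K)).tgA₂ x₂ y₂)) := ⟨_, rfl⟩
  obtain ⟨u₂, hu₂def⟩ : ∃ u : AlgebraicClosure K, u =
      (V₁.baseChange (AlgebraicClosure K)).tgA₃ x₂ y₂ /
        (V₁.baseChange (AlgebraicClosure K)).tgA₂ x₂ y₂ := ⟨_, rfl⟩
  obtain ⟨hd₁, hd₁1, hK1₁, hK2₁, hK3₁, s, hjs, htag₁⟩ := hrest₁ d₁ u₁ hd₁def hu₁def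
  obtain ⟨hd₂, hd₂1, hK1₂, hK2₂, hK3₂, t, hjt, htag₂⟩ := hrest₂ d₂ u₂ hd₂def hu₂def
  have hu₁ : u₁ ≠ 0 := hu₁def ▸ div_ne_zero hA3₁ hA2₁
  have hu₂ : u₂ ≠ 0 := hu₂def ▸ div_ne_zero hA3₂ hA2₂
  obtain ⟨hs0, hj0, hj1728⟩ := klein_seven_j_ne h21 h27 hq hjs
  obtain ⟨ht0, -, -⟩ := klein_seven_j_ne h21 h27 hq hjt
  refine ⟨s, t, ?_, hs0, ht0, by linear_combination s * hjt - t * hjs⟩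
  -- the two values are distinct
  intro hst
  apply hne
  -- equal values ⇒ equal Hauptmodul values of the two Tate parameters
  have hηeq : (d₁ ^ 3 - 8 * d₁ ^ 2 + 5 * d₁ + 1) * (d₂ * (d₂ - 1)) =
      (d₂ ^ 3 - 8 * d₂ ^ 2 + 5 * d₂ + 1) * (d₁ * (d₁ - 1)) := by
    rw [← htag₁, ← htag₂, hst]
    ring
  obtain ⟨hc4, hc6⟩ := c₄_c₆_baseChange_ne_zero hj0 hj1728 (AlgebraicClosure K)
  -- points of order `7` are not `2`-torsion
  have hy₁ : y₁ ≠ (V₁.baseChange (AlgebraicClosure K)).toAffine.negY x₁ y₁ := fun hyy ↦ by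
    have h2 : (2 : ℕ) • (Affine.Point.some x₁ y₁ h₁ : V₁.geomPoints) = 0 := by
      rw [two_nsmul]
      exact Affine.Point.add_self_of_Y_eq hyy
    have h72 : (7 : ℕ) ∣ 2 := ho₁ ▸ addOrderOf_dvd_of_nsmul_eq_zero h2
    omega
  have hy₂ : y₂ ≠ (V₁.baseChange (AlgebraicClosure K)).toAffine.negY x₂ y₂ := fun hyy ↦ by
    have h2 : (2 : ℕ) • (Affine.Point.some x₂ y₂ h₂ : V₁.geomPoints) = 0 := by
      rw [two_nsmul]
      exact Affine.Point.add_self_of_Y_eq hyy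
    have h72 : (7 : ℕ) ∣ 2 := ho₂ ▸ addOrderOf_dvd_of_nsmul_eq_zero h2
    omega
  -- the two tangent normalisations, in Kubert's shape by (B)
  have hV₁' := variableChange_tangent_eq (W := V₁.baseChange (AlgebraicClosure K)) h₁.1 hy₁
  have hV₂' := variableChange_tangent_eq (W := V₁.baseChange (AlgebraicClosure K)) h₂.1 hy₂
  have key := hC (V₁.baseChange (AlgebraicClosure K))
    ⟨1, x₁, (V₁.baseChange (AlgebraicClosure K)).toAffine.slope x₁ x₁ y₁ y₁, y₁⟩
    ⟨1, x₂, (V₁.baseChange (AlgebraicClosure K)).toAffine.slope x₂ x₂ y₂ y₂, y₂⟩ u₁ d₁ u₂ d₂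
    rfl rfl
    (by rw [hV₁']; exact hK1₁) (by rw [hV₁']; exact hK2₁) (by rw [hV₁']; exact hK3₁)
    (by rw [hV₁']) (by rw [hV₁'])
    (by rw [hV₂']; exact hK1₂) (by rw [hV₂']; exact hK2₂) (by rw [hV₂']; exact hK3₂)
    (by rw [hV₂']) (by rw [hV₂'])
    hu₁ hu₂ (mul_ne_zero hd₁ hd₁1) (mul_ne_zero hd₂ hd₂1) hηeq hc4 hc6
  -- (C) says `x₂ ∈ {x₁, x(2P₁), x(3P₁)}`, hence `P₂ ∈ ℤP₁`
  exact mem_zmultiples_of_kubert_x h₁ h₂ hy₁ hu₁ hd₁ hd₁1 hK1₁ hK2₁ hK3₁ key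

end Literature.NumberTheory.EllipticCurves

end
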